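import Summits.ValiantsHypothesis.ValiantsHypothesis.Theorems.BarrierLeverChowBenchmarkPairsSplit

/-!
# Route BarrierLever — item 22038 `ChowBenchmarkPairs`, line `moore-peel`: the WEIGHTED pendant extension lemma
# (the pendant step of THEOREM PS «pure-splittable families are Haar» for Dirichlet-weighted rows)

Helper file (`--supports stmt-ValiantsHypothesis-22038`; cell valiant-natproofs, rung V4; seat val-np-p4 gen 23).  Closes NO item.

`…ChowBenchmarkPairsHaar.pendant_extension` adjoins to a nonsingular family of segment rows `segE` one row with a NEW point on one new
column.  The multi-point split engine (`…ChowBenchmarkPairsSplit`) works with WEIGHTED rows `dirE P S w T = [θ^T] ∏_{a∈S} R_a^{w_a}` (the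
`c`-block of a split raises one weight), so the recursion «pendant step / pure split» of THEOREM PS (memo HOME/val-np-p4/g23/ §8) needs the
pendant step for weighted rows.  This file proves it, from the general sum formula (no closed forms): with the new point `q := x·𝟙_U`,

* `dirE_adjoin_map` — old rows do not see the new point;
* `natDegree_dirE_new_le` — a row through `q` has `x`-degree `≤ |T ∩ U|` at column `T` (each coordinate `c ∈ T` sent to `q` contributes the factor
  `x·[c ∈ U]`, the others constants);
* `coeff_dirE_new_of_not_subset` / `coeff_dirE_new_self` — its `x^{|U|}`-coefficient vanishes unless `U ⊆ T`, and at `T = U` equals `w_q^{(|U|)}`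
  (`Nat.ascFactorial`; only the constant map `T → {q}` reaches degree `|U|`);
* **`weighted_pendant_extension[_finite]`** — if `[dirE P (S i) (w i) (T j)]` is nonsingular at ANY table `P`, the new column `U` lies in no `T j`, and
  the new row `Snew ∋ q` (old points of `Snew` arbitrary, weight `w q ≥ 1`), then the bordered matrix at the table `P ⊔ {x·𝟙_U}` is nonsingular for all but
  finitely many `x` (top-coefficient matrix block triangular `[[old, *], [0, w_q^{(|U|)}]]`, as in the unweighted lemma).

WHAT THIS IS NOT: no stub of the line is closed; nothing on crux stmt-ValiantsHypothesis-14610 or on `VP` versus `VNP`.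
-/

set_option linter.dupNamespace false

namespace Summit.ValiantsHypothesis.ValiantsHypothesis.Theorems.BarrierLever.ChowBenchmarkSplit

open Finset Polynomial
open Summit.ValiantsHypothesis.ValiantsHypothesis.Theorems.BarrierLever.ChowBenchmarkPeel
  (coeff_det_of_natDegree_le adjoin adjoin_none adjoin_some liftEquiv liftEquiv_val indPt constTable symbTable)

variable {κ : Type*} [DecidableEq κ] {R : Type*} [CommRing R] {n : ℕ}

/-! ## 1. Old rows in the enlarged table -/

/-- An old row (weights read through `some`) has the same weighted entries in the enlarged configuration. -/
theorem dirE_adjoin_map (P : Fin n → κ → R) (q : κ → R) (S : Finset (Fin n)) (w : Fin n → ℕ) (w' : Option (Fin n) → ℕ)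
    (hw : ∀ a, w' (some a) = w a) (T : Finset κ) :
    dirE (adjoin P q) (S.map Function.Embedding.some) w' T = dirE P S w T := by
  classical
  unfold dirE
  set e := liftEquiv S with he
  refine Fintype.sum_equiv (Equiv.arrowCongr (Equiv.refl ↥T) e.symm) _ _ fun g => ?_
  have hga : ∀ c : ↥T, (Equiv.arrowCongr (Equiv.refl ↥T) e.symm g) c = e.symm (g c) := by
    intro c
    simp only [Equiv.arrowCongr_apply, Function.comp_apply, Equiv.refl_symm, Equiv.refl_apply]
  have hg : ∀ c : ↥T, ((g c : ↥(S.map Function.Embedding.some)) : Option (Fin n)) =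
      some ((e.symm (g c) : ↥S) : Fin n) := by
    intro c
    conv_lhs => rw [← e.apply_symm_apply (g c)]
    rfl
  congr 1
  · refine Finset.prod_congr rfl fun c _ => ?_
    rw [hga c, hg c]
    rfl
  · refine Fintype.prod_equiv e.symm _ _ fun a => ?_
    have hf : (Finset.univ.filter fun c : ↥T => g c = a) =
        Finset.univ.filter fun c : ↥T => (Equiv.arrowCongr (Equiv.refl ↥T) e.symm g) c = e.symm a := by
      ext c
      simp only [Finset.mem_filter, Finset.mem_univ, true_and]
      rw [hga c]
      exact e.symm.injective.eq_iff.symm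
    have ha : ((a : ↥(S.map Function.Embedding.some)) : Option (Fin n)) = some ((e.symm a : ↥S) : Fin n) := by
      conv_lhs => rw [← e.apply_symm_apply a]
      rfl
    rw [hf, ha, hw]

/-! ## 2. A row through the new point `x·𝟙_U`: degree and top coefficient -/

section NewRow

variable (P : Fin n → κ → R) (U : Finset κ) (S : Finset (Option (Fin n))) (w : Option (Fin n) → ℕ)

/-- The coordinate factor of the symbolic table: a constant at an old point, `X·[c ∈ U]` at the new one. -/
theorem natDegree_symbTable_le (o : Option (Fin n)) (c : κ) :
    (symbTable P U o c).natDegree ≤ if o = none ∧ c ∈ U then 1 else 0 := by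
  cases o with
  | none =>
    show (indPt U (X : R[X]) c).natDegree ≤ _
    unfold indPt
    by_cases hc : c ∈ U
    · rw [if_pos hc, if_pos ⟨rfl, hc⟩]
      exact Polynomial.natDegree_X_le
    · rw [if_neg hc, Polynomial.natDegree_zero]
      exact Nat.zero_le _
  | some a =>
    have hne : ¬ ((some a : Option (Fin n)) = none ∧ c ∈ U) := fun h => Option.some_ne_none a h.1
    rw [if_neg hne]
    show (C (P a c)).natDegree ≤ 0
    rw [natDegree_C]

/-- A summand of the new row: the coordinate product over `g : T → S` has degree at most the number of coordinates of `T ∩ U` sent to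
the new point. -/
theorem natDegree_prod_symbTable_le {T : Finset κ} (g : ↥T → ↥S) :
    (∏ c : ↥T, symbTable P U (g c) c).natDegree ≤
      (Finset.univ.filter fun c : ↥T => ((g c : Option (Fin n)) = none ∧ (c : κ) ∈ U)).card := by
  refine (Polynomial.natDegree_prod_le _ _).trans ?_
  rw [Finset.card_filter]
  exact Finset.sum_le_sum fun c _ => natDegree_symbTable_le P U _ _

/-- **Degree bound**: a row through the new point has `x`-degree `≤ |T ∩ U|` at column `T`. -/
theorem natDegree_dirE_new_le (T : Finset κ) :
    (dirE (symbTable P U) S w T).natDegree ≤ (T ∩ U).card := by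
  classical
  unfold dirE
  refine (Polynomial.natDegree_sum_le_of_forall_le _ _ fun g _ => ?_)
  refine (Polynomial.natDegree_mul_le).trans ?_
  have h2 : (∏ a : ↥S, (((w a).ascFactorial (Finset.univ.filter fun c : ↥T => g c = a).card : ℕ) : R[X])).natDegree = 0 := by
    rw [← Nat.cast_prod, Polynomial.natDegree_natCast]
  rw [h2, add_zero]
  refine (natDegree_prod_symbTable_le P U S g).trans ?_
  -- the filtered coordinates inject into `T ∩ U`
  rw [← Finset.card_map (Function.Embedding.subtype _)]
  apply Finset.card_le_card
  intro c hc
  simp only [Finset.mem_map, Finset.mem_filter, Finset.mem_univ, true_and, Function.Embedding.coe_subtype] at hc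
  obtain ⟨c', ⟨_, hcU⟩, rfl⟩ := hc
  exact Finset.mem_inter.mpr ⟨c'.2, hcU⟩

/-- Below `U` the top coefficient vanishes: if `¬ U ⊆ T` then the `x^{|U|}`-coefficient of the new row at `T` is `0`. -/
theorem coeff_dirE_new_of_not_subset (T : Finset κ) (hT : ¬ U ⊆ T) :
    (dirE (symbTable P U) S w T).coeff U.card = 0 := by
  apply Polynomial.coeff_eq_zero_of_natDegree_lt
  refine lt_of_le_of_lt (natDegree_dirE_new_le P U S w T) ?_
  apply Finset.card_lt_card
  refine Finset.ssubset_iff_subset_ne.mpr ⟨Finset.inter_subset_right, fun e => hT ?_⟩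
  rw [← e]
  exact Finset.inter_subset_left

/-- **Top coefficient at the new column**: if `q = none ∈ S`, the `x^{|U|}`-coefficient of the new row at `T = U` is `w_q^{(|U|)}`
(only the constant map `U → {q}` reaches degree `|U|`). -/
theorem coeff_dirE_new_self (hq : none ∈ S) :
    (dirE (symbTable P U) S w U).coeff U.card = ((w none).ascFactorial U.card : R) := by
  classical
  unfold dirE
  rw [Polynomial.finsetSum_coeff]
  set g₀ : ↥U → ↥S := fun _ => ⟨none, hq⟩ with hg₀
  rw [Finset.sum_eq_single g₀]
  · -- the constant map: `∏_{c∈U} X = X^{|U|}`, weights `w_q^{(|U|)} · ∏_{a ≠ q} w_a^{(0)}`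
    have hprod : (∏ c : ↥U, symbTable P U (g₀ c) c) = X ^ U.card := by
      rw [show (∏ c : ↥U, symbTable P U (g₀ c) c) = ∏ c : ↥U, (X : R[X]) from
        Finset.prod_congr rfl fun c _ => by simp [hg₀, symbTable, adjoin_none, indPt, c.2]]
      rw [Finset.prod_const, Finset.card_univ, Fintype.card_coe]
    have hw : (∏ a : ↥S, (((w a).ascFactorial (Finset.univ.filter fun c : ↥U => g₀ c = a).card : ℕ) : R[X])) =
        (((w none).ascFactorial U.card : ℕ) : R[X]) := by
      rw [Finset.prod_eq_single (⟨none, hq⟩ : ↥S)]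
      · have : (Finset.univ.filter fun c : ↥U => g₀ c = ⟨none, hq⟩) = Finset.univ :=
          Finset.filter_true_of_mem fun c _ => rfl
        rw [this, Finset.card_univ, Fintype.card_coe]
      · intro a _ ha
        have : (Finset.univ.filter fun c : ↥U => g₀ c = a) = ∅ :=
          Finset.filter_false_of_mem fun c _ => fun e => ha (e ▸ rfl)
        rw [this, Finset.card_empty, Nat.ascFactorial_zero, Nat.cast_one]
      · intro h; exact absurd (Finset.mem_univ _) h
    rw [hprod, hw, mul_comm, ← Polynomial.C_eq_natCast, Polynomial.coeff_C_mul_X_pow, if_pos rfl]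
  · -- any other map misses degree `|U|`
    intro g _ hg
    apply Polynomial.coeff_eq_zero_of_natDegree_lt
    refine (Polynomial.natDegree_mul_le).trans_lt ?_
    have h2 : (∏ a : ↥S, (((w a).ascFactorial (Finset.univ.filter fun c : ↥U => g c = a).card : ℕ) : R[X])).natDegree = 0 := by
      rw [← Nat.cast_prod, Polynomial.natDegree_natCast]
    rw [h2, add_zero]
    refine (natDegree_prod_symbTable_le P U S g).trans_lt ?_
    -- some coordinate is NOT sent to the new point
    obtain ⟨c₀, hc₀⟩ : ∃ c₀ : ↥U, (g c₀ : Option (Fin n)) ≠ none := by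
      by_contra hall
      apply hg
      funext c
      apply Subtype.ext
      by_contra hc
      exact hall ⟨c, hc⟩
    rw [← Fintype.card_coe U, ← Finset.card_univ]
    apply Finset.card_lt_card
    refine Finset.ssubset_iff_subset_ne.mpr ⟨Finset.filter_subset _ _, fun e => hc₀ ?_⟩
    have : c₀ ∈ Finset.univ.filter fun c : ↥U => ((g c : Option (Fin n)) = none ∧ (c : κ) ∈ U) := by
      rw [e]; exact Finset.mem_univ _
    exact (Finset.mem_filter.mp this).2.1
  · intro h; exact absurd (Finset.mem_univ _) h

end NewRow

/-! ## 3. The weighted pendant extension -/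

section Pendant

variable {ι : Type*} [Fintype ι] [DecidableEq ι]

/-- The rows of the bordered matrix: old rows `S i` read through `some` with weights `w i`, and the new row `Snew ∋ none` with weights `wnew`. -/
def wRow (S : ι → Finset (Fin n)) (Snew : Finset (Option (Fin n))) : ι ⊕ Unit → Finset (Option (Fin n)) :=
  Sum.elim (fun i => (S i).map Function.Embedding.some) (fun _ => Snew)

/-- The weights of the bordered matrix. -/
def wWt (w : ι → Fin n → ℕ) (wnew : Option (Fin n) → ℕ) : ι ⊕ Unit → Option (Fin n) → ℕ :=
  Sum.elim (fun i o => o.elim 0 (w i)) (fun _ => wnew)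

/-- The columns of the bordered matrix. -/
def wCol (T : ι → Finset κ) (U : Finset κ) : ι ⊕ Unit → Finset κ := Sum.elim T (fun _ => U)

/-- The symbolic bordered matrix over `R[X]` (new point `X·𝟙_U`). -/
noncomputable def wBordX (P : Fin n → κ → R) (S : ι → Finset (Fin n)) (w : ι → Fin n → ℕ) (Snew : Finset (Option (Fin n)))
    (wnew : Option (Fin n) → ℕ) (T : ι → Finset κ) (U : Finset κ) : Matrix (ι ⊕ Unit) (ι ⊕ Unit) R[X] :=
  Matrix.of fun i j => dirE (symbTable P U) (wRow S Snew i) (wWt w wnew i) (wCol T U j)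

omit [Fintype ι] [DecidableEq ι] in
/-- Old rows of the symbolic bordered matrix are constants. -/
theorem wBordX_inl (P : Fin n → κ → R) (S : ι → Finset (Fin n)) (w : ι → Fin n → ℕ) (Snew : Finset (Option (Fin n)))
    (wnew : Option (Fin n) → ℕ) (T : ι → Finset κ) (U : Finset κ) (i : ι) (j : ι ⊕ Unit) :
    wBordX P S w Snew wnew T U (Sum.inl i) j = C (dirE P (S i) (w i) (wCol T U j)) := by
  rw [wBordX, Matrix.of_apply, wRow, Sum.elim_inl, wWt, Sum.elim_inl, symbTable,
    dirE_adjoin_map _ _ _ (w i) _ (fun a => rfl), map_dirE C]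
  rfl

/-- Evaluating the symbolic bordered matrix at `x`. -/
theorem eval_det_wBordX (P : Fin n → κ → R) (S : ι → Finset (Fin n)) (w : ι → Fin n → ℕ) (Snew : Finset (Option (Fin n)))
    (wnew : Option (Fin n) → ℕ) (T : ι → Finset κ) (U : Finset κ) (x : R) :
    (wBordX P S w Snew wnew T U).det.eval x = (Matrix.of fun i j : ι ⊕ Unit =>
      dirE (adjoin P (indPt U x)) (wRow S Snew i) (wWt w wnew i) (wCol T U j)).det := by
  classical
  have h1 : (Polynomial.evalRingHom x) (wBordX P S w Snew wnew T U).det =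
      ((Polynomial.evalRingHom x).mapMatrix (wBordX P S w Snew wnew T U)).det := RingHom.map_det _ _
  rw [Polynomial.coe_evalRingHom] at h1
  rw [h1]
  congr 1
  ext i j
  rw [RingHom.mapMatrix_apply, Matrix.map_apply, wBordX, Matrix.of_apply, Matrix.of_apply,
    Polynomial.coe_evalRingHom, ← Polynomial.coe_evalRingHom, map_dirE]
  congr 1
  funext o c
  cases o with
  | none =>
    simp only [symbTable, adjoin_none, indPt, Polynomial.coe_evalRingHom]
    split_ifs <;> simp
  | some a => simp [symbTable, constTable]

variable [IsDomain R]

/-- **The weighted bordered determinant is a nonzero polynomial.**  Old rows nonsingular on old columns at `P`, new column `U` in no old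
column, new row through the new point with weight `wnew none ≥ 1` (cast nonzero in `R`): then `det (wBordX …) ≠ 0` in `R[X]`. -/
theorem det_wBordX_ne_zero (P : Fin n → κ → R) (S : ι → Finset (Fin n)) (w : ι → Fin n → ℕ) (Snew : Finset (Option (Fin n)))
    (hq : none ∈ Snew) (wnew : Option (Fin n) → ℕ) (T : ι → Finset κ) (U : Finset κ)
    (hw : (((wnew none).ascFactorial U.card : ℕ) : R) ≠ 0) (hU : ∀ j, ¬ U ⊆ T j)
    (hold : (Matrix.of fun i j : ι => dirE P (S i) (w i) (T j)).det ≠ 0) :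
    (wBordX P S w Snew wnew T U).det ≠ 0 := by
  classical
  set MX := wBordX P S w Snew wnew T U with hMX
  set v : ι ⊕ Unit → R[X] := Sum.elim (fun _ => X ^ U.card) (fun _ => 1) with hv
  set MX' : Matrix (ι ⊕ Unit) (ι ⊕ Unit) R[X] := Matrix.of fun i j => v i * MX i j with hMX'
  have hdet' : MX'.det = (∏ i, v i) * MX.det := Matrix.det_mul_column v MX
  suffices hne' : MX'.det ≠ 0 by
    intro h0; apply hne'; rw [hdet', h0, mul_zero]
  have hdeg : ∀ i j, (MX' i j).natDegree ≤ U.card := by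
    intro i j
    rw [hMX', Matrix.of_apply]
    cases i with
    | inl i =>
      rw [hv, Sum.elim_inl, hMX, wBordX_inl, mul_comm]
      exact natDegree_C_mul_X_pow_le _ _
    | inr _ =>
      rw [hv, Sum.elim_inr, one_mul, hMX, wBordX, Matrix.of_apply, wRow, Sum.elim_inr, wWt, Sum.elim_inr]
      exact (natDegree_dirE_new_le P U Snew wnew _).trans (Finset.card_le_card Finset.inter_subset_right)
  have htop : (Matrix.of fun i j => (MX' i j).coeff U.card) =
      Matrix.fromBlocks (Matrix.of fun i j : ι => dirE P (S i) (w i) (T j))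
        (Matrix.of fun (i : ι) (_ : Unit) => dirE P (S i) (w i) U)
        0 (Matrix.of fun _ _ : Unit => (((wnew none).ascFactorial U.card : ℕ) : R)) := by
    ext i j
    rcases i with i | i' <;> rcases j with j | j'
    · rw [Matrix.of_apply, Matrix.fromBlocks_apply₁₁, Matrix.of_apply, hMX', Matrix.of_apply, hv, Sum.elim_inl, hMX,
        wBordX_inl, wCol, Sum.elim_inl, mul_comm, coeff_C_mul_X_pow, if_pos rfl]
    · rw [Matrix.of_apply, Matrix.fromBlocks_apply₁₂, Matrix.of_apply, hMX', Matrix.of_apply, hv, Sum.elim_inl, hMX,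
        wBordX_inl, wCol, Sum.elim_inr, mul_comm, coeff_C_mul_X_pow, if_pos rfl]
    · rw [Matrix.of_apply, Matrix.fromBlocks_apply₂₁, Matrix.zero_apply, hMX', Matrix.of_apply, hv, Sum.elim_inr, one_mul, hMX,
        wBordX, Matrix.of_apply, wRow, Sum.elim_inr, wWt, Sum.elim_inr, wCol, Sum.elim_inl]
      exact coeff_dirE_new_of_not_subset P U Snew wnew (T j) (hU j)
    · rw [Matrix.of_apply, Matrix.fromBlocks_apply₂₂, Matrix.of_apply, hMX', Matrix.of_apply, hv, Sum.elim_inr, one_mul, hMX,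
        wBordX, Matrix.of_apply, wRow, Sum.elim_inr, wWt, Sum.elim_inr, wCol, Sum.elim_inr]
      exact coeff_dirE_new_self P U Snew wnew hq
  have hcoeff : MX'.det.coeff (Fintype.card (ι ⊕ Unit) * U.card) ≠ 0 := by
    rw [coeff_det_of_natDegree_le MX' U.card hdeg, htop, Matrix.det_fromBlocks_zero₂₁]
    refine mul_ne_zero hold ?_
    rw [Matrix.det_unique, Matrix.of_apply]
    exact hw
  intro h0
  rw [h0, coeff_zero] at hcoeff
  exact hcoeff rfl

/-- **WEIGHTED PENDANT EXTENSION, cofinite form.** -/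
theorem weighted_pendant_extension_finite (P : Fin n → κ → R) (S : ι → Finset (Fin n)) (w : ι → Fin n → ℕ)
    (Snew : Finset (Option (Fin n))) (hq : none ∈ Snew) (wnew : Option (Fin n) → ℕ)
    (T : ι → Finset κ) (U : Finset κ) (hw : (((wnew none).ascFactorial U.card : ℕ) : R) ≠ 0)
    (hU : ∀ j, ¬ U ⊆ T j)
    (hold : (Matrix.of fun i j : ι => dirE P (S i) (w i) (T j)).det ≠ 0) :
    Set.Finite {x : R | (Matrix.of fun i j : ι ⊕ Unit =>
      dirE (adjoin P (indPt U x)) (wRow S Snew i) (wWt w wnew i) (wCol T U j)).det = 0} := by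
  have hne := det_wBordX_ne_zero P S w Snew hq wnew T U hw hU hold
  refine (Polynomial.finite_setOf_isRoot hne).subset fun x hx => ?_
  rw [Set.mem_setOf_eq, Polynomial.IsRoot.def, eval_det_wBordX]
  exact hx

/-- **WEIGHTED PENDANT EXTENSION LEMMA** (over an infinite domain, e.g. `ℂ`).  If the weighted rows `(S i, w i)` are nonsingular on the
columns `T j` at the table `P`, the new column `U` lies in no `T j`, and the new row `Snew` contains the NEW point (`none`) with a weight whose
rising factorial `w_q^{(|U|)}` is nonzero in `R` (automatic for `w_q ≥ 1` in characteristic zero), then for some scalar `x` the bordered matrix at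
the table `P ⊔ {x·𝟙_U}` is nonsingular.  Old points are NOT assumed generic. -/
theorem weighted_pendant_extension [Infinite R] (P : Fin n → κ → R) (S : ι → Finset (Fin n)) (w : ι → Fin n → ℕ)
    (Snew : Finset (Option (Fin n))) (hq : none ∈ Snew) (wnew : Option (Fin n) → ℕ)
    (T : ι → Finset κ) (U : Finset κ) (hw : (((wnew none).ascFactorial U.card : ℕ) : R) ≠ 0)
    (hU : ∀ j, ¬ U ⊆ T j)
    (hold : (Matrix.of fun i j : ι => dirE P (S i) (w i) (T j)).det ≠ 0) :
    ∃ x : R, (Matrix.of fun i j : ι ⊕ Unit =>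
      dirE (adjoin P (indPt U x)) (wRow S Snew i) (wWt w wnew i) (wCol T U j)).det ≠ 0 := by
  obtain ⟨x, hx⟩ := Set.Infinite.nonempty (Set.Finite.infinite_compl
    (weighted_pendant_extension_finite P S w Snew hq wnew T U hw hU hold))
  exact ⟨x, hx⟩

end Pendant

end Summit.ValiantsHypothesis.ValiantsHypothesis.Theorems.BarrierLever.ChowBenchmarkSplit
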